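import Summits.Langlands.Langlands.Theses.HolomorphicShadow

/-!
# `HolomorphicShadow.SectorComplement` (stmt-Langlands-14623) — logical position (SUSPECT-EQUIVALENCE audit)

Crux-strategist unit `cstrat-stmt-Langlands-14623-q1` (2026-08-17). The payload witness
`Theorems.skinnerWilesDefectOne_sectorComplement_iff_of_target` (Theorems/SkinnerWilesDefectOneSectorComplement.lean:51)
concerns the HOMONYMOUS frame item of route SkinnerWilesDefectOne (`ReducibleOrdinaryModular → Langlands`,
stmt-Langlands-12923), a different statement. This file records the identical position for THIS route's junction
`SectorComplement : Prop := <lets>; (H) → _root_.Langlands` (H = `EvenMaassSlice` below: Γ₀(L)-automorphy with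
character χ of the Maass lift φ_(a,ε) of every admissible Artin datum of every irreducible σ : Γ_ℚ → GL₂(ℂ)),
kernel-checked:

* `hs_sectorComplement_iff` : `SectorComplement ↔ (EvenMaassSlice → Langlands)` (by `Iff.rfl`);
* `hs_sectorComplement_of_langlands` : `Langlands → SectorComplement`;
* `hs_evenMaassSlice_of_cruxes` : `ShadowModularity → ShadowConverse → EvenMaassSlice` (the body of the route's
  `closes` short of its last step: X delivers H by pure logic);
* `hs_sectorComplement_iff_of_slice` : under H, `SectorComplement ↔ Langlands`;
* `hs_sectorComplement_iff_of_cruxes` : under the two ranked cruxes `ShadowModularity` (r2) and `ShadowConverse` (r3) —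
  the other two binders of `closes` — `SectorComplement ↔ Langlands` (the suspect equivalence, verbatim for this route);
* `hs_not_sectorComplement_iff` : `¬ SectorComplement ↔ EvenMaassSlice ∧ ¬ Langlands`;
* `hs_sectorComplement_iff_not_or` : truth table `SectorComplement ↔ ¬ EvenMaassSlice ∨ Langlands`.

`Langlands → EvenMaassSlice` and `Langlands → ShadowModularity` are deliberately absent: true in substance (direction (B)
of the summit for even Artin σ gives a cuspidal π; its new vector is the Maass form φ; Sturm forward gives the shadows) but
not formal in the tree (no classical-Maass-newform ← automorphic-representation dictionary, no Sturm theorem). Verdict of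
the audit (EQUIVALENCE-AUDIT_HolomorphicShadow.md): equivalence-benign — the two sibling binders of `closes` are OPEN and
substantive; no item of the route is proved.
-/

set_option linter.dupNamespace false

namespace Summit.Langlands.Langlands.Cruxes.SectorComplement.EquivalenceAuditHS

open Summit.Langlands.Langlands.Theses.HolomorphicShadow

/-- **H — the even-Maass slice** (the antecedent of `SectorComplement`, verbatim with its `let` gadgets): for every
irreducible σ : Γ_ℚ → GL₂(ℂ) and every admissible Artin datum (N > 0, χ mod N, ε = ±1 with σ(c) = ε·1, a polynomially
bounded and Euler-pinned to σ away from N) there is a level L > 0, N ∣ L, at which the Maass lift φ_(a,ε) is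
Γ₀(L)-automorphic with character χ. [folklore] -/
def EvenMaassSlice : Prop :=
  let K0 : ℝ → ℝ := fun x => ∫ t in Set.Ioi (0 : ℝ), Real.exp (-(x * Real.cosh t)); let maass : (ℕ → ℂ) → ℂ → UpperHalfPlane → ℂ := fun a ε z => ∑' n : ℕ, a (n + 1) * ((Real.sqrt z.im * K0 (2 * Real.pi * ((n : ℝ) + 1) * z.im) : ℝ) : ℂ) * (Complex.exp (2 * Real.pi * Complex.I * ((n : ℂ) + 1) * (z.re : ℂ)) + ε * Complex.exp (-(2 * Real.pi * Complex.I * ((n : ℂ) + 1) * (z.re : ℂ)))); let EulerPin : Literature.NumberTheory.GaloisRepresentations.FramedGaloisRep ℚ ℂ 2 → (N : ℕ) → DirichletCharacter ℂ N → (ℕ → ℂ) → Prop := fun σ N χ a => a 1 = 1 ∧ (∀ m n : ℕ, Nat.Coprime m n → a (m * n) = a m * a n) ∧ (∀ p : ℕ, p.Prime → p ∣ N → ∀ j : ℕ, a (p ^ (j + 1)) = 0) ∧ (∀ p : ℕ, p.Prime → ¬ p ∣ N → (∀ j : ℕ, a (p ^ (j + 2)) = a p * a (p ^ (j + 1)) -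 χ (p : ZMod N) * a (p ^ j)) ∧ ∀ v : IsDedekindDomain.HeightOneSpectrum (NumberField.RingOfIntegers ℚ), (p : NumberField.RingOfIntegers ℚ) ∈ v.asIdeal → Literature.NumberTheory.GaloisRepresentations.FramedGaloisRep.IsUnramifiedAt v σ ∧ Literature.NumberTheory.GaloisRepresentations.FramedGaloisRep.HasFrobCharpolyAt v (Polynomial.X ^ 2 - Polynomial.C (a p) * Polynomial.X + Polynomial.C (χ (p : ZMod N))) σ); let ParityPin : Literature.NumberTheory.GaloisRepresentations.FramedGaloisRep ℚ ℂ 2 → ℂ → Prop := fun σ ε => ∀ (φ : ℚ →+* ℝ) (c : Field.absoluteGaloisGroup ℚ), Literature.NumberTheory.GaloisRepresentations.IsComplexConjugation φ c → ((σ c : GL (Fin 2) ℂ) : Matrix (Fin 2) (Fin 2) ℂ) = ε • (1 : Matrix (Fin 2) (Fin 2) ℂ); ∀ σ : Literature.NumberTheory.GaloisRepresentations.FramedGaloisRep ℚ ℂ 2, σ.toGaloisRep.IsIrreducible → ∀ (N : ℕ) (χ : DirichletCharacter ℂ N) (ε : ℂ) (a : ℕ → ℂ), 0 < N → (ε = 1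 ∨ ε = -1) → ParityPin σ ε → (∃ C A : ℝ, ∀ n : ℕ, ‖a n‖ ≤ C * ((n : ℝ) + 1) ^ A) → EulerPin σ N χ a → ∃ L : ℕ, 0 < L ∧ N ∣ L ∧ ∀ γ ∈ CongruenceSubgroup.Gamma0 L, ∀ z : UpperHalfPlane, maass a ε (γ • z) = χ ((((γ : Matrix (Fin 2) (Fin 2) ℤ) 1 1 : ℤ) : ZMod N)) * maass a ε z

/-- The junction is literally `H → Langlands`. [folklore] -/
theorem hs_sectorComplement_iff : SectorComplement ↔ (EvenMaassSlice → _root_.Langlands) :=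
  Iff.rfl

/-- The junction is implied by the summit (discard H). [folklore] -/
theorem hs_sectorComplement_of_langlands : _root_.Langlands → SectorComplement :=
  fun h _ ↦ h

/-- X = ShadowModularity ∧ ShadowConverse delivers H by pure logic (the body of `closes` minus its last step: good level
L₀ from ShadowModularity, then ShadowConverse at (N, L₀, χ, ψ = 1, k₀ = 4)). [folklore] -/
theorem hs_evenMaassSlice_of_cruxes (hSM : ShadowModularity) (hSC : ShadowConverse) : EvenMaassSlice := by
  intro σ hirr N χ ε a hN hε hpar hgrowth hpin
  obtain ⟨L₀, hL₀, hNL₀, hmod⟩ := hSM σ hirr N χ ε a hN hε hpar hpin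
  exact ⟨L₀, hL₀, hNL₀, hSC N L₀ χ (1 : DirichletCharacter ℂ L₀) ε a 4 hN hNL₀ hL₀ hε hgrowth
    (fun k hk b g hg => hmod k hk L₀ (dvd_refl L₀) hL₀ 1 b g hg)⟩

/-- Under H the junction IS the summit. [folklore] -/
theorem hs_sectorComplement_iff_of_slice (hH : EvenMaassSlice) : SectorComplement ↔ _root_.Langlands :=
  ⟨fun hC ↦ hC hH, fun h _ ↦ h⟩

/-- Under the other two binders of `closes` — the ranked cruxes `ShadowModularity` (r2) and `ShadowConverse` (r3) — the
junction is equivalent to the summit (`→` is the route's sorry-free `closes`). [folklore] -/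
theorem hs_sectorComplement_iff_of_cruxes (hSM : ShadowModularity) (hSC : ShadowConverse) :
    SectorComplement ↔ _root_.Langlands :=
  ⟨fun hC ↦ closes hSM hSC hC, fun h _ ↦ h⟩

/-- The same equivalence through H (independent of `closes`). [folklore] -/
theorem hs_sectorComplement_iff_of_cruxes' (hSM : ShadowModularity) (hSC : ShadowConverse) :
    SectorComplement ↔ _root_.Langlands :=
  hs_sectorComplement_iff_of_slice (hs_evenMaassSlice_of_cruxes hSM hSC)

/-- Exact content of a refutation of the junction: prove H (even strong Artin over ℚ in Maass-form form, OPEN) AND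
disprove the formal summit. [folklore] -/
theorem hs_not_sectorComplement_iff : ¬ SectorComplement ↔ EvenMaassSlice ∧ ¬ _root_.Langlands :=
  Classical.not_imp

/-- Any refutation of the junction is a disproof of the formal summit. [folklore] -/
theorem hs_not_langlands_of_not_sectorComplement : ¬ SectorComplement → ¬ _root_.Langlands :=
  fun h ↦ (hs_not_sectorComplement_iff.1 h).2

/-- Truth table of the junction. [folklore] -/
theorem hs_sectorComplement_iff_not_or : SectorComplement ↔ ¬ EvenMaassSlice ∨ _root_.Langlands :=
  imp_iff_not_or

/-- The route's `Assembly` item (stmt-Langlands-14644) is the type of `closes`. [folklore] -/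
theorem hs_assembly : Assembly :=
  fun hSM hSC hC ↦ closes hSM hSC hC

/-- The route's slice glue `EvenArtinFromShadows` (stmt-Langlands-14114) factors through H: X gives H, and the two
dictionaries turn H into the target `EvenStrongArtinSC`. [folklore] -/
theorem hs_evenArtinFromShadows : EvenArtinFromShadows := by
  intro hSM hSC hME hAD σ hirr heven
  obtain ⟨N, χ, ε, a, hN, hε, hpar, hgrowth, hpin⟩ := hAD σ hirr heven
  obtain ⟨L, hL, hNL, haut⟩ := hs_evenMaassSlice_of_cruxes hSM hSC σ hirr N χ ε a hN hε hpar hgrowth hpin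
  exact hME σ hirr N L χ ε a hN hNL hL hε hgrowth hpin haut

end Summit.Langlands.Langlands.Cruxes.SectorComplement.EquivalenceAuditHS
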